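import Mathlib.Analysis.Normed.Group.InfiniteSum
import Mathlib.Analysis.Normed.Module.Basic
import Mathlib.Topology.Algebra.InfiniteSum.Real
import Mathlib.Topology.Algebra.InfiniteSum.Constructions
import Mathlib.Algebra.Order.Antidiag.Prod
import Mathlib.Data.Nat.Choose.Sum
import Mathlib.Algebra.BigOperators.Field
import Mathlib.Algebra.Module.BigOperators
import HarnessLib

/-!
# The Cauchy–binomial regrouping `Σ_{m,n} (aᵐ bⁿ ∕ (m! n!)) • F (m+n) = Σ_N ((a+b)^N ∕ N!) • F N` in a Banach space

Topic `Analysis/Calculus`; namespace `Literature.NumberTheory.Automorphic.CauchyBinomial` (consumed by the exponential series of the road below);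
theorems only (no definition, no named fact, no `sorry`).  Cell `hodgecm-mathlib`, F0∕P3, ROAD-GLOB to the letter A6 `HasUnitaryGlobalizationOfInfUnitary`
at `U(2,1)`, brick **P1** (first of three files): the one piece of series calculus behind the isometry, the local group law and the strong composition
identity of the exponential of a skew operator on analytic vectors ([Nelson1959, §2]; [HarishChandra1953, §9]).

THE MATHEMATICS ([Rudin1976, Thm. 3.50 (Cauchy product) and Ch. 8, the addition formula of `exp`]).  Let `W` be a complete real normed space,
`F : ℕ → W`, `a, b ∈ ℝ` with `Σ_N ((|a|+|b|)^N ∕ N!) ‖F N‖ < ∞`.  Then the double family `(m,n) ↦ (aᵐ bⁿ ∕ (m! n!)) • F (m+n)` is (absolutely)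
summable (`summable_prod`), its sum is `Σ_N ((a+b)^N ∕ N!) • F N` (`hasSum_prod`; regroup along the antidiagonals `m + n = N`, Mathlib
`Finset.HasAntidiagonal.sigmaAntidiagonalEquivProd`, and use `Σ_{m+n=N} N!∕(m!n!) aᵐ bⁿ = (a+b)^N`, `sum_antidiagonal_pow_mul_pow_div_factorial`), and
the iterated sums converge to the same value (`hasSum_iterated`, `summable_column`).  With `F N = emb (Z^N v)` this is `exp(aZ) exp(bZ) v =
exp((a+b)Z) v`; with `F N = ⟪emb v, emb (Z^N w)⟫` and `(−a, b)` it is `⟪exp(aZ) v, exp(bZ) w⟫ = ⟪v, exp((b−a)Z) w⟫` for skew `Z`.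

## Mathlib search
`Commute.add_pow'` (binomial theorem over `antidiagonal`), `Nat.add_choose_mul_factorial_mul_factorial`, `summable_sigma_of_nonneg`,
`Summable.of_norm_bounded`, `HasSum.sigma`, `HasSum.prod_fiberwise`, `Summable.prod_symm`∕`.prod_factor`, `Equiv.hasSum_iff`.  Mathlib's own Cauchy
product (`tsum_mul_tsum_eq_tsum_sum_antidiagonal_of_summable_norm`) is for PRODUCT families `f m * g n` in a normed ring; the family here couples `m`
and `n` through `F (m+n)`, hence this file.  Dedup: `rg "CauchyBinomial|antidiagonal_pow_mul_pow"` over `Literature/` — no hits.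

## References
* W. Rudin, *Principles of Mathematical Analysis*, 3rd ed. (1976), Thm. 3.50; Ch. 8 (the exponential function) [Rudin1976].
* E. Nelson, *Analytic vectors*, Ann. of Math. 70 (1959), §2 [Nelson1959].
-/

set_option autoImplicit false

noncomputable section

open Finset
open scoped Nat

namespace Literature.NumberTheory.Automorphic

namespace CauchyBinomial

variable {W : Type*} [NormedAddCommGroup W] [NormedSpace ℝ W] [CompleteSpace W]

/-- The binomial identity over the antidiagonal with factorial weights:
`Σ_{(m,n), m+n=N} a^m b^n ∕ (m! n!) = (a+b)^N ∕ N!`. [cite: Rudin1976, Thm. 3.50; Ch. 8] -/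
theorem sum_antidiagonal_pow_mul_pow_div_factorial (a b : ℝ) (N : ℕ) :
    ∑ mn ∈ antidiagonal N, a ^ mn.1 * b ^ mn.2 / ((mn.1 ! : ℝ) * (mn.2 ! : ℝ)) = (a + b) ^ N / (N ! : ℝ) := by
  rw [(Commute.all a b).add_pow', Finset.sum_div]
  refine Finset.sum_congr rfl fun mn hmn => ?_
  rw [mem_antidiagonal] at hmn
  have h := Nat.add_choose_mul_factorial_mul_factorial mn.2 mn.1
  rw [add_comm, hmn] at h
  have hN : (N ! : ℝ) = (N.choose mn.1 : ℝ) * (mn.1 ! : ℝ) * (mn.2 ! : ℝ) := by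
    have h' := congrArg (Nat.cast (R := ℝ)) h
    push_cast at h'
    rw [← h']; ring
  rw [nsmul_eq_mul, hN]
  have h1 : (mn.1 ! : ℝ) ≠ 0 := by positivity
  have h2 : (mn.2 ! : ℝ) ≠ 0 := by positivity
  have h3 : (N.choose mn.1 : ℝ) ≠ 0 := by
    have : N.choose mn.1 ≠ 0 := by
      rw [← hmn]; exact Nat.ne_of_gt (Nat.choose_pos (Nat.le_add_right _ _))
    exact_mod_cast this
  field_simp

/-- **Summability of the Cauchy–binomial double family** `(m,n) ↦ (a^m b^n ∕ (m! n!)) • F (m+n)` from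
`Σ_N ((|a|+|b|)^N ∕ N!) ‖F N‖ < ∞`. [cite: Rudin1976, Thm. 3.50; Ch. 8] -/
theorem summable_prod (a b : ℝ) (F : ℕ → W) (hF : Summable fun N => (|a| + |b|) ^ N / (N ! : ℝ) * ‖F N‖) :
    Summable fun mn : ℕ × ℕ => (a ^ mn.1 * b ^ mn.2 / ((mn.1 ! : ℝ) * (mn.2 ! : ℝ))) • F (mn.1 + mn.2) := by
  -- dominate by the nonnegative family `g`, summed along antidiagonals
  set g : ℕ × ℕ → ℝ := fun mn => |a| ^ mn.1 * |b| ^ mn.2 / ((mn.1 ! : ℝ) * (mn.2 ! : ℝ)) * ‖F (mn.1 + mn.2)‖ with hg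
  have hg0 : ∀ mn, 0 ≤ g mn := fun mn => by positivity
  have hgs : Summable g := by
    have hσ : Summable (g ∘ (Finset.HasAntidiagonal.sigmaAntidiagonalEquivProd (A := ℕ))) := by
      refine (summable_sigma_of_nonneg fun x => hg0 _).mpr ⟨fun N => (hasSum_fintype _).summable, ?_⟩
      refine hF.congr fun N => ?_
      rw [tsum_fintype, Finset.univ_eq_attach]
      have hfib : ∑ x ∈ (antidiagonal N).attach, (g ∘ Finset.HasAntidiagonal.sigmaAntidiagonalEquivProd) ⟨N, x⟩ =
          ∑ mn ∈ antidiagonal N, g mn := Finset.sum_attach (antidiagonal N) g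
      refine Eq.trans ?_ hfib.symm
      have hrw : ∀ mn ∈ antidiagonal N, g mn = (|a| ^ mn.1 * |b| ^ mn.2 / ((mn.1 ! : ℝ) * (mn.2 ! : ℝ))) * ‖F N‖ := by
        intro mn hmn; rw [mem_antidiagonal] at hmn; simp only [hg, hmn]
      rw [Finset.sum_congr rfl hrw, ← Finset.sum_mul, sum_antidiagonal_pow_mul_pow_div_factorial]
    exact (Finset.HasAntidiagonal.sigmaAntidiagonalEquivProd (A := ℕ)).summable_iff.mp hσ
  refine Summable.of_norm_bounded hgs fun mn => ?_
  rw [norm_smul, Real.norm_eq_abs, abs_div, abs_mul, abs_pow, abs_pow, abs_mul,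
    abs_of_pos (by positivity : (0 : ℝ) < mn.1 !), abs_of_pos (by positivity : (0 : ℝ) < mn.2 !)]

/-- **The Cauchy–binomial identity**: the double family has sum `Σ_N ((a+b)^N ∕ N!) • F N`. [cite: Rudin1976, Thm. 3.50; Ch. 8] -/
theorem hasSum_prod (a b : ℝ) (F : ℕ → W) (hF : Summable fun N => (|a| + |b|) ^ N / (N ! : ℝ) * ‖F N‖) :
    HasSum (fun mn : ℕ × ℕ => (a ^ mn.1 * b ^ mn.2 / ((mn.1 ! : ℝ) * (mn.2 ! : ℝ))) • F (mn.1 + mn.2))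
      (∑' N, ((a + b) ^ N / (N ! : ℝ)) • F N) := by
  have hs := summable_prod a b F hF
  set f : ℕ × ℕ → W := fun mn => (a ^ mn.1 * b ^ mn.2 / ((mn.1 ! : ℝ) * (mn.2 ! : ℝ))) • F (mn.1 + mn.2) with hf
  -- transport to the sigma type of antidiagonals and sum fiberwise
  have hσ : HasSum (f ∘ (Finset.HasAntidiagonal.sigmaAntidiagonalEquivProd (A := ℕ))) (∑' mn, f mn) :=
    (Finset.HasAntidiagonal.sigmaAntidiagonalEquivProd (A := ℕ)).hasSum_iff.mpr hs.hasSum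
  have hfib : ∀ N : ℕ, HasSum (fun x : antidiagonal N => (f ∘ Finset.HasAntidiagonal.sigmaAntidiagonalEquivProd) ⟨N, x⟩)
      (((a + b) ^ N / (N ! : ℝ)) • F N) := by
    intro N
    have h := hasSum_fintype (fun x : antidiagonal N => (f ∘ Finset.HasAntidiagonal.sigmaAntidiagonalEquivProd) ⟨N, x⟩)
    have hval : ∑ x : antidiagonal N, (f ∘ Finset.HasAntidiagonal.sigmaAntidiagonalEquivProd) ⟨N, x⟩ =
        ((a + b) ^ N / (N ! : ℝ)) • F N := by
      rw [Finset.univ_eq_attach]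
      refine Eq.trans (Finset.sum_attach (antidiagonal N) f) ?_
      have hrw : ∀ mn ∈ antidiagonal N, f mn = (a ^ mn.1 * b ^ mn.2 / ((mn.1 ! : ℝ) * (mn.2 ! : ℝ))) • F N := by
        intro mn hmn; rw [mem_antidiagonal] at hmn; simp only [hf, hmn]
      rw [Finset.sum_congr rfl hrw, ← Finset.sum_smul, sum_antidiagonal_pow_mul_pow_div_factorial]
    rwa [hval] at h
  have hN : HasSum (fun N => ((a + b) ^ N / (N ! : ℝ)) • F N) (∑' mn, f mn) := hσ.sigma hfib
  rw [hN.tsum_eq]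
  exact hs.hasSum

/-- Summability of the regrouped series `Σ_N ((a+b)^N ∕ N!) • F N`. [cite: Rudin1976, Thm. 3.50; Ch. 8] -/
theorem summable_regrouped (a b : ℝ) (F : ℕ → W) (hF : Summable fun N => (|a| + |b|) ^ N / (N ! : ℝ) * ‖F N‖) :
    Summable fun N => ((a + b) ^ N / (N ! : ℝ)) • F N := by
  refine Summable.of_norm_bounded hF fun N => ?_
  rw [norm_smul, Real.norm_eq_abs, abs_div, abs_of_pos (by positivity : (0 : ℝ) < N !), abs_pow]
  gcongr
  exact abs_add_le a b

/-- **Iterated form** (columns first): `Σ_n Σ_m (a^m b^n ∕ (m! n!)) • F (m+n) = Σ_N ((a+b)^N ∕ N!) • F N`, each inner series summable.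
[cite: Rudin1976, Thm. 3.50; Ch. 8] -/
theorem hasSum_iterated (a b : ℝ) (F : ℕ → W) (hF : Summable fun N => (|a| + |b|) ^ N / (N ! : ℝ) * ‖F N‖) :
    HasSum (fun n : ℕ => ∑' m : ℕ, (a ^ m * b ^ n / ((m ! : ℝ) * (n ! : ℝ))) • F (m + n))
      (∑' N, ((a + b) ^ N / (N ! : ℝ)) • F N) := by
  have h := hasSum_prod a b F hF
  have hs := summable_prod a b F hF
  -- swap to `(n, m)` order and sum fiberwise
  have h' : HasSum (fun nm : ℕ × ℕ => (a ^ nm.2 * b ^ nm.1 / ((nm.2 ! : ℝ) * (nm.1 ! : ℝ))) • F (nm.2 + nm.1))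
      (∑' N, ((a + b) ^ N / (N ! : ℝ)) • F N) := by
    have := (Equiv.prodComm ℕ ℕ).hasSum_iff.mpr h
    exact this
  refine h'.prod_fiberwise fun n => ?_
  have hsn : Summable fun m : ℕ => (a ^ m * b ^ n / ((m ! : ℝ) * (n ! : ℝ))) • F (m + n) :=
    (hs.prod_symm).prod_factor n
  exact hsn.hasSum

/-- Summability of each column `m ↦ (a^m b^n ∕ (m! n!)) • F (m+n)`. [cite: Rudin1976, Thm. 3.50; Ch. 8] -/
theorem summable_column (a b : ℝ) (F : ℕ → W) (hF : Summable fun N => (|a| + |b|) ^ N / (N ! : ℝ) * ‖F N‖) (n : ℕ) :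
    Summable fun m : ℕ => (a ^ m * b ^ n / ((m ! : ℝ) * (n ! : ℝ))) • F (m + n) :=
  ((summable_prod a b F hF).prod_symm).prod_factor n

end CauchyBinomial

end Literature.NumberTheory.Automorphic

end
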